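import Literature.AnabelianGeometry.EtaleTheta.Discharge.Sec1Prop15iiiForcesShear
import Literature.AnabelianGeometry.EtaleTheta.KummerDataOfCoreConj
import Literature.AnabelianGeometry.EtaleTheta.SettingModelChiSectionPoints
import Literature.AnabelianGeometry.EtaleTheta.SettingModelGfpSlim
import HarnessLib

/-!
# The typed [EtTh] Prop. 1.5 (iii) FAILS at the split χ-twisted root model `modelχ` — for EVERY class `η̈`
# (stage-1 census of the R78 cluster; proof-only instantiation of `Sec1Prop15iiiForcesShear`)

S. Mochizuki, *The étale theta function and its Frobenioid-theoretic manifestations*, Publ. RIMS **45**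
(2009) [EtTh], §1, Prop. 1.5 (iii), PRIMS PDF p. 23 (printed 249): "… on which `a ∈ Z` acts as follows:
`η̈^Θ ↦ η̈^Θ − 2a·log(Ü) − (a²/2)·log(q_X) + log(O^×_K̈)`" [cite: MochizukiEtTh2009, Prop 1.5 (iii) p.23].
Layer L2 of the abc-iut cell, seat abc-iut-L2-t12 (gen 5), ROW R184 «Prop 1.5 (iii)» follow-on E1 (R78 cluster,
STAGE 1). PROOF-ONLY over abc-iut-w5-d171's `kummerCoreχ` / `logUddχ` / `yThetaχ` (`SettingModelChiKummerData`),
abc-iut-L2-t6's `kummerDataχSec` / `etaleThetaDataχSec` (`SettingModelChiSectionPoints`), abc-iut-L2-t1's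
`ThetaSetting.modelχ` / `chiTwistData`, and this seat's `KummerDataOfCoreConj` (unit-class stability hU, q̈-law hQ
at the section datum) + `Sec1Prop15iiiForcesShear` (the no-go) — all consumed BY NAME; no `def`, no instance.

RESULT `SettingModel.not_prop15iii_etaleThetaDataχSec`: at the χ-twisted root model (stage 1: Galois acts on
`Γ` by `b ↦ b^{χ}`, `a ↦ a` — «split-Tate, q Kummer-trivial on the ℤ-direction»), for EVERY class
`η̈ ∈ H¹(Π^tp_Ÿ, Δ_Θ)` the étale-theta datum `etaleThetaDataχSec p η̈` over the section Kummer datum does NOT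
satisfy `ThetaSetting.Prop15iii`. Reason (`Sec1Prop15iiiForcesShear`): the pure deck generator
`σ₀ := (a, 1) ∈ Γ ⋊ G_{ℚ_p}` (`toZ σ₀ = 1`) FIXES `log(Ü) =` the class of `h ↦ c^{ŷ(h)/2}` on the nose —
`ŷ` (the `b`-exponent sum) is invariant under conjugation by `a`, and `(a, 1)` centralises `Δ_Θ` (its image
under `augTheta` is `1`) — whereas the typed `Z`-action clause forces `(σ₀·log Ü)² ≡ (log Ü·κ(q̈))²` modulo unit
classes, i.e. `q_X = p² ∈ O^×` — absurd. This is the kernel form of the integrator's label «EXPECTED-FALSE AT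
STAGE 1 BY DESIGN, witnessed at stage 2» (abc-iut-L6-d6): the `−a²·log(q̈)` term requires the Tate shear
`a ↦ a·b^{2κ_p}·c^{−κ_p}` of `modelχq`. Generic by-product: `KummerCore.conjNormal_eq_self_of_augTheta_eq_one`.
HONEST FRAMING: SEMI-SYNTHETIC MODEL, consistency evidence for the typed interface only; nothing of [EtTh] is
asserted or denied; typed ≠ proved; no side is taken on [IUTchIII] Cor. 3.12.
-/

noncomputable section

namespace Literature.AnabelianGeometry.EtaleTheta

open Literature.AnabelianGeometry.SemiGraphs

/-! ### Generic: elements over `1 ∈ G_{ℚ_p}` centralise `Δ_Θ` -/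

namespace ThetaSetting.KummerCore

variable {p : ℕ} [Fact p.Prime] {D : ThetaSetting p} (C : D.KummerCore)

/-- If `augTheta g = 1` then `g` CENTRALISES `Δ_Θ` (the conjugation action on `Δ_Θ = coeffHom(Ẑ(1))` is through
`augTheta`). [cite: MochizukiEtTh2009, Prop 1.5 p.23] -/
theorem conjNormal_eq_self_of_augTheta_eq_one {g : D.GtpTheta} (hg : C.augTheta g = 1) (a : D.DeltaTheta) :
    MulAut.conjNormal g a = a := by
  obtain ⟨ζ, rfl⟩ := C.bijective_coeffHom.2 a
  rw [← C.coeffHom_smul, hg, one_smul]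

end ThetaSetting.KummerCore

namespace SettingModel

open _root_.Topology

variable (p : ℕ) [Fact p.Prime]

/-! ### The pure deck generator `σ₀ = (a, 1)` of `Π^tp_X(modelχ) = Γ ⋊_χ G_{ℚ_p}` -/

/-- `toZ (a, 1) = 1`. [cite: MochizukiEtTh2009, §1 p.12] -/
theorem toZ_modelχ_inl_genA :
    (ThetaSetting.modelχ p).toZ
        (SemidirectProduct.inl (⟨(eta (FreeGroup.of 0), expA (FreeGroup.of 0)), eta_mk_mem_Gfp _⟩ : Gfp)) =
      Multiplicative.ofAdd 1 := by
  change gfpSnd (SemidirectProduct.inl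
    (⟨(eta (FreeGroup.of 0), expA (FreeGroup.of 0)), eta_mk_mem_Gfp _⟩ : Gfp) : PiTpχ p).left = _
  rw [SemidirectProduct.left_inl]
  exact expA_of_zero

/-- `aug (a, 1) = 1`. [cite: MochizukiEtTh2009, §1 p.12] -/
theorem aug_modelχ_inl (γ : Gfp) : (ThetaSetting.modelχ p).aug (SemidirectProduct.inl γ) = 1 := rfl

/-- `ŷ(a, 1) = 1` and `ŷ((a, 1)⁻¹) = 1` (the `b`-exponent sum of `a^{±1}` vanishes). [cite: MochizukiEtTh2009, §1 p.12] -/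
theorem yCoordχ_inl_genA_zpow (k : ℤ) :
    yCoordχ p ((SemidirectProduct.inl
      (⟨(eta (FreeGroup.of 0), expA (FreeGroup.of 0)), eta_mk_mem_Gfp _⟩ : Gfp) : PiTpχ p) ^ k) = 1 := by
  rw [← map_zpow, yCoordχ, SemidirectProduct.left_inl, map_zpow, map_zpow, gfpFst_apply]
  change eHatB (eta (FreeGroup.of 0)) ^ k = 1
  rw [eHatB_eta_of_zero, one_zpow]

/-- **Conjugation by the pure deck generator fixes `ŷ`** on `(Π^tp_X)^Θ`: `ŷ(σ₀⁻¹ x σ₀) = ŷ(x)`.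
[cite: MochizukiEtTh2009, Prop 1.5 p.23] -/
theorem yThetaχ_conj_genA (x : CurveTheta.GTheta (curveχ p)) :
    yThetaχ p ((CurveTheta.toTheta (curveχ p) (SemidirectProduct.inl
        (⟨(eta (FreeGroup.of 0), expA (FreeGroup.of 0)), eta_mk_mem_Gfp _⟩ : Gfp)))⁻¹ * x *
      CurveTheta.toTheta (curveχ p) (SemidirectProduct.inl
        (⟨(eta (FreeGroup.of 0), expA (FreeGroup.of 0)), eta_mk_mem_Gfp _⟩ : Gfp))) = yThetaχ p x := by
  set σ₀ : PiTpχ p := SemidirectProduct.inl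
    (⟨(eta (FreeGroup.of 0), expA (FreeGroup.of 0)), eta_mk_mem_Gfp _⟩ : Gfp) with hσ₀
  have hy1 : yThetaχ p (CurveTheta.toTheta (curveχ p) σ₀) = 1 := by
    rw [yThetaχ_toTheta]; simpa using yCoordχ_inl_genA_zpow p 1
  have hy2 : yThetaχ p (CurveTheta.toTheta (curveχ p) σ₀)⁻¹ = 1 := by
    rw [← map_inv, yThetaχ_toTheta]; simpa using yCoordχ_inl_genA_zpow p (-1)
  have haug : CurveTheta.augTheta (curveχ p) (CurveTheta.toTheta (curveχ p) σ₀)⁻¹ = 1 := by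
    rw [← map_inv, CurveTheta.augTheta_toTheta]
    change (ThetaSetting.modelχ p).aug σ₀⁻¹ = 1
    rw [map_inv, hσ₀, aug_modelχ_inl, inv_one]
  rw [yThetaχ_mul, yThetaχ_mul, hy1, hy2, map_one, mul_one, one_mul, haug, map_one, MulAut.one_apply]

/-- **The pure deck generator FIXES `log(Ü)`** at `modelχ` (on the nose: `σ₀·log(Ü) = log(Ü)`).
[cite: MochizukiEtTh2009, Prop 1.5 (iii) p.23] -/
theorem conj_genA_logUddχ (hC : (ThetaSetting.modelχ p).Compat) :
    haveI := hC.GtpYddTheta_normal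
    ContH1.conj (MonoidHom.id (ThetaSetting.modelχ p).GtpTheta) (ThetaSetting.modelχ p).DeltaTheta
        ((ThetaSetting.modelχ p).toTheta (SemidirectProduct.inl
          (⟨(eta (FreeGroup.of 0), expA (FreeGroup.of 0)), eta_mk_mem_Gfp _⟩ : Gfp)))
        (logUddχ p) = logUddχ p := by
  haveI := hC.GtpYddTheta_normal
  set σ₀ : PiTpχ p := SemidirectProduct.inl
    (⟨(eta (FreeGroup.of 0), expA (FreeGroup.of 0)), eta_mk_mem_Gfp _⟩ : Gfp) with hσ₀
  have haugΘ : (kummerCoreχ p).augTheta ((ThetaSetting.modelχ p).toTheta σ₀) = 1 := by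
    rw [(kummerCoreχ p).augTheta_toTheta, hσ₀, aug_modelχ_inl]
  change ContH1.conj _ _ _ (QuotientGroup.mk ⟨logUddFunχ p, logUddFunχ_mem p⟩) =
    QuotientGroup.mk ⟨logUddFunχ p, logUddFunχ_mem p⟩
  rw [ContH1.conj_mk]
  congr 1
  apply Subtype.ext
  funext h
  have hconj : ∀ a : (ThetaSetting.modelχ p).DeltaTheta,
      MulAut.conjNormal ((ThetaSetting.modelχ p).toTheta σ₀) a = a :=
    fun a => (kummerCoreχ p).conjNormal_eq_self_of_augTheta_eq_one haugΘ a
  rw [ContH1.conjCocycle_apply, MonoidHom.id_apply]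
  refine (hconj _).trans ?_
  -- the inner argument: `ŷ(σ₀⁻¹ h σ₀) = ŷ(h)`
  change deltaThetaCoordχ p (half ⟨yThetaχ p _, _⟩) = deltaThetaCoordχ p (half ⟨yThetaχ p _, _⟩)
  congr 2
  apply Subtype.ext
  change yThetaχ p ((MulAut.conjNormal ((ThetaSetting.modelχ p).toTheta σ₀)⁻¹ h : _) : _) = yThetaχ p h
  rw [MulAut.conjNormal_apply, inv_inv]
  exact yThetaχ_conj_genA p h

/-! ### The no-go at stage 1 -/

/-- **Prop. 1.5 (iii) as typed FAILS at the split χ-model for EVERY `η̈`** (over the section Kummer datum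
`kummerDataχSec`, the one on which points are evaluated). [cite: MochizukiEtTh2009, Prop 1.5 (iii) p.23] -/
theorem not_prop15iii_etaleThetaDataχSec (hC : (ThetaSetting.modelχ p).Compat)
    (η : (ThetaSetting.modelχ p).H1 (ThetaSetting.modelχ p).GtpYdd) :
    ¬ ThetaSetting.Prop15iii (etaleThetaDataχSec p η) hC := by
  haveI := hC.GtpYddTheta_normal
  refine (etaleThetaDataχSec p η).not_prop15iii_of_conj_logUdd_mem_units hC
    ((kummerCoreχ p).conj_kumYdd_units_ofSection SemidirectProduct.inr (continuous_inr_modelχ p)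
      (aug_modelχ_inr p) (map_inr_GK_le_GtpY_modelχ p) (map_inr_GKdd_le_GtpYdd_modelχ p) hC)
    ((kummerCoreχ p).conj_kumYdd_qddUnit_ofSection SemidirectProduct.inr (continuous_inr_modelχ p)
      (aug_modelχ_inr p) (map_inr_GK_le_GtpY_modelχ p) (map_inr_GKdd_le_GtpYdd_modelχ p) hC)
    (toZ_modelχ_inl_genA p) ⟨1, (ThetaSetting.modelχ p).unitsOKdd.one_mem, ?_⟩
  rw [map_one, map_one, mul_one]
  exact conj_genA_logUddχ p hC

/-- Census form: NO étale-theta datum over `kummerDataχSec` satisfies the typed Prop. 1.5 (iii) at `modelχ` via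
`etaleThetaDataOfClass` — contrast: Prop. 1.5 (i)/(ii) DO hold there (abc-iut-L6-d5's `prop15ii_kummerDataχSec`).
[cite: MochizukiEtTh2009, Prop 1.5 (iii) p.23] -/
theorem forall_not_prop15iii_etaleThetaDataχSec (hC : (ThetaSetting.modelχ p).Compat) :
    ∀ η : (ThetaSetting.modelχ p).H1 (ThetaSetting.modelχ p).GtpYdd,
      ¬ ThetaSetting.Prop15iii (etaleThetaDataχSec p η) hC :=
  fun η => not_prop15iii_etaleThetaDataχSec p hC η

end SettingModel

end Literature.AnabelianGeometry.EtaleTheta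

end
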